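import Mathlib
import HarnessLib
import Summits.NavierStokesRegularity.NavierStokesRegularity.Theorems.QuarterLogPincerTypeIQuantSubcubicExpABRootRooting

/-!
# Route `QuarterLogPincer`, crux `TypeIQuantSubcubicExp` (stmt-NavierStokesRegularity-24077), line `ab_root` — part 2/2:
# THE LEFT EDGES `TypeILiouvilleAB → TypeIQuantSubcubicExp`, `ThinTowerLiouville → TypeIQuantSubcubicExp` (crux BY NAME, NO STUB)

Tree copy (part 2 of 2) of ns-idea-7 g8's line `Cruxes/TypeIQuantSubcubicExp/Lines/ab_root.lean` v2
(sha12 533ab3821881; idea-crit-4 PASS 19:07:36Z / 19:13:03Z 2026-08-28; typed audit ns-afl-r1 g9 19:34:03Z),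
landed verbatim by the pub-ns-dss typer (g35); part 1 = `…ABRootRooting` (objects `CascadeTwinLimit` /
`CascadeRooting` / `ABTransfer`, (S1) `cascadeRooting`, (S2) `abTransfer`, (S1⁺)
`exists_thinObject_and_cascadeTwinLimit_of_cheapCascades`).  The author's line docstring follows.


ns-idea-7 g8, second line (lens «nearmiss», target «DSS wall»).  LEFT-EDGE LINE (calibration polarity,
the companion of `Lines/truncation_edge.lean`): the Liouville CORE of sub-route H3 / crux 23843,
`TypeILiouvilleAB` («every Type-I ancient mild tower in Albritton–Barker's class is regular at the
origin», tree `…SatelliteTowerEnvelopeDefs`), IMPLIES the crux 24077; equivalently, by the tree's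
factorisation `envelopedExclusions_iff_typeILiouvilleAB`, the two exclusions (E1⁺) `¬ EnvelopedLeaf`
and (E2) `¬ InfiniteDescent` of 23843's census imply 24077.  No summit is proved by this line; 24077,
23843, (L′) = `TypeILiouvilleAB`, (E1⁺), (E2), the DSS wall and Navier–Stokes regularity are OPEN.

## The near-miss of record and its measured deficit

* NEAR-MISS: the tree edge `typeIQuantSubcubicExp_of_rateLiouville` (line `thin_cascade`, file
  `…LiouvilleEdges`): Liouville for the WHOLE rate class `IsTypeIAncientMild` (every bounded-rate
  ancient mild solution vanishes) ⇒ 24077.  Its DEFICIT is the CLASS: the rate class `p = ∞` carries no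
  local energy information — Albritton–Barker 2019, Remark 3.2 [corpus:paper-arxiv-1811.00502 p.7
  L71–74]: «it is not clear … `sup √(−t)‖v‖_∞ < ∞` alone does not appear to guarantee `𝐈 < ∞`»; the
  Liouville theorems one can hope to prove (and the whole satellite-tower census of 23843: `ABTower`,
  `RootObj`, `EnvelopedLeaf`, `InfiniteDescent`, `critRate`, the small-constant and axisymmetric kills)
  live in the A–B class `𝐈 < ∞`.
* SINGLE INPUT (now PROVED in the tree, the measured improvement): the 4th stub `UniformScaledEnergy`
  (I1, p619610) ⇒ the uniform Albritton–Barker bound of the zooms `exists_typeIBound_zoom_le`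
  (`…ZoomTypeIBoundC`), and the summit-side eventual compactness engine
  `local_typeI_compactness_twin_inBall_evt` (`…BudgetCompactnessEventual`) which keeps the class
  `IsSuitableWeakSolutionInBall R 0` of the limit on EVERY ball and bounds `𝐈` of the limit.
* THE MOVE («rooting»): run the thin-cascade zoom of 24077 through the 23843 engine instead of the
  Literature engine, and identify the engine's `L³_loc` limit a.e. with the KNSS limit `W`
  (`IsTypeIAncientMild M W`) of `exists_typeIAncientMild_zoomLimit_of_cheapCascades`; the a.e.-invariance
  of every clause of `ABTower` (`IsSuitableWeakSolutionInBall.congr_ae'`, `HasWeakSpatialGradientOn.congr_ae`,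
  `typeIBound_congr_ae`) makes `W` itself an `ABTower M W P H` with a backward singular origin — an
  object `TypeILiouvilleAB` forbids.

## Content (ALL KERNEL-CHECKED — this line has NO stub; its obligations S1/S1⁺/S2 are proved here; v2 19:09Z adds S1⁺ and the thin-tower edge)

* (S1) `cascadeRooting : CascadeRooting` — cheap cascades of every length at `(M, q)` produce
  CASCADE TWIN-LIMIT data `CascadeTwinLimit M W U P H` (KNSS limit `W`, engine limit `(U, P, H)` in the
  A–B class on every ball and on the slab, `𝐈 < ∞`, `U = W` a.e. on every `Q(0,R)`, backward singular
  origin).  Re-assembly of the tree's `isBackwardSingularPoint_zoomLimit` around the `_evt` engine.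
* (S2) `abTransfer : ABTransfer` — such data make `W` a singular tower: `ABTower M W P H ∧ ¬ RegPt W 0`.
* THE EDGE `typeIQuantSubcubicExp_of_typeILiouvilleAB : TypeILiouvilleAB → TypeIQuantSubcubicExp`
  (the crux BY NAME), `typeIQuantSubcubicExp_of_envelopedExclusions` ((E1⁺) ∧ (E2) ⇒ 24077), and the
  object form `exists_singular_abTower_of_not_typeIQuantSubcubicExp` (failure of 24077 produces a
  singular A–B tower = an object of 23843's census; THE INSTRUMENT ROW).
* (S1⁺, v2) `exists_thinObject_and_cascadeTwinLimit_of_cheapCascades` — the SAME KNSS limit `W` is the THIN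
  OBJECT of line `thin_cascade` (`ThinObject M q W g`, verbatim the landed S2 assembly) AND rooted; hence the
  SHARPEST LEFT EDGE `typeIQuantSubcubicExp_of_thinTowerLiouville : ThinTowerLiouville → TypeIQuantSubcubicExp`,
  where `ThinTowerLiouville` («every KNSS limit that is both a thin object and an A–B tower is regular at the
  origin») is the MEET of the two known left hypotheses — S3 `stub_thinCascadeLiouville` of line `thin_cascade`
  (`thinTowerLiouville_of_noThinObject`) and (L′) (`thinTowerLiouville_of_typeILiouvilleAB`).  READING FOR THE
  LEAD of 24077: the open deciding stub S3 may ASSUME its thin object is a suitable weak solution of A–B class on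
  every `Q(0,a)` with `𝐈 < ∞` (so ε-regularity / A–B compactness / local energy tools apply to it) — S3 is
  WEAKENED to S3′ = `ThinTowerLiouville` at no cost (`exists_thin_singular_abTower_of_not_typeIQuantSubcubicExp`).

With `Lines/truncation_edge.lean` (24077 ⇒ (E1⁺) modulo T1/T3/T4) the crux is PINNED inside H3:
(E1⁺) ∧ (E2) ⟺ (L′) ⇒ 24077 ⇒ (E1⁺); the residual of W7 = 24077 over (E1⁺) is at most (E2)
(infinite satellite descent), over (L′) it is nil.

bears_on: LADDER-NS W7 (24077) / H3 (23843: (L′), (E1⁺), (E2)); instrument row = the satellite-tower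
census of 23843 (any `ABTower` with `¬ RegPt · 0` kills 24077: `not_typeIQuantSubcubicExp_of_singular_abTower`).
-/

noncomputable section

set_option linter.dupNamespace false

namespace Summit.NavierStokesRegularity.NavierStokesRegularity.Cruxes.TypeIQuantSubcubicExp.AbRoot

open MeasureTheory Set Function Filter Topology Metric
open scoped ENNReal NNReal InnerProductSpace RealInnerProductSpace
open Literature.Analysis Literature.Analysis.FluidPDE
open Summit.NavierStokesRegularity.NavierStokesRegularity.Cruxes.TypeIQuantSubcubicExp.ThinCascade
open Summit.NavierStokesRegularity.NavierStokesRegularity.Theorems.ThinCascade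
open Summit.NavierStokesRegularity.NavierStokesRegularity.Cruxes.ScarEnvelopeTypeI.ZoomDictionary

/-! ### The edge -/

/-- **Cheap cascades of every length produce a SINGULAR A–B TOWER** (S1 + S2). [this file; line theorem] -/
theorem exists_singular_abTower_of_cheapCascades {M q : ℝ} (hq : 0 < q)
    (hK : ∀ K : ℕ, CheapCascade M q K) :
    ∃ (W : ℝ → EuclideanSpace ℝ (Fin 3) → EuclideanSpace ℝ (Fin 3))
      (P : ℝ → EuclideanSpace ℝ (Fin 3) → ℝ)
      (H : ℝ → EuclideanSpace ℝ (Fin 3) → EuclideanSpace ℝ (Fin 3) →L[ℝ] EuclideanSpace ℝ (Fin 3)),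
      ABTower M W P H ∧ ¬ RegPt W 0 := by
  obtain ⟨W, U, P, H, hT⟩ := cascadeRooting M q hq hK
  exact ⟨W, P, H, abTransfer M W U P H hT⟩

/-- The crux body at a fixed Type-I constant from Liouville in the A–B class AT `M`. [this file; line theorem] -/
theorem quantSubcubicExpAt_of_abLiouvilleAt (M : ℝ)
    (hL : ∀ (W : ℝ → EuclideanSpace ℝ (Fin 3) → EuclideanSpace ℝ (Fin 3))
      (P : ℝ → EuclideanSpace ℝ (Fin 3) → ℝ)
      (H : ℝ → EuclideanSpace ℝ (Fin 3) → EuclideanSpace ℝ (Fin 3) →L[ℝ] EuclideanSpace ℝ (Fin 3)),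
      ABTower M W P H → RegPt W 0) :
    ∃ F : ℝ → ℝ, (∀ ε : ℝ, 0 < ε → ∃ A₀ : ℝ, ∀ A : ℝ, A₀ ≤ A → F A ≤ Real.exp (ε * A ^ 3)) ∧
      ∀ (T τ A : ℝ) (u : ℝ → EuclideanSpace ℝ (Fin 3) → EuclideanSpace ℝ (Fin 3))
        (p : ℝ → EuclideanSpace ℝ (Fin 3) → ℝ),
        (IsClassicalNSSolutionOn (Icc 0 T) 1 0 u p ∧ ∀ n : ℕ, ∃ C : NNReal, ∀ t ∈ Icc 0 T,
            eLpNorm (iteratedFDeriv ℝ n (u t)) 2 volume ≤ C) → 0 < τ →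
        (∀ t ∈ Icc 0 T, ∀ x : EuclideanSpace ℝ (Fin 3), ‖u t x‖ ≤ M * (T + τ - t) ^ (-(1 / 2 : ℝ))) →
        (∀ t ∈ Icc 0 T, eLpNorm (u t) 3 volume ≤ ENNReal.ofReal A) → 2 ≤ A →
        ∀ t ∈ Ioc 0 T, ∀ x : EuclideanSpace ℝ (Fin 3), ‖u t x‖ ≤ F A * t ^ (-(1 / 2 : ℝ)) := by
  refine quantSubcubicExpAt_of_forbiddenLengths M fun q hq => ?_
  by_contra h
  push Not at h
  obtain ⟨W, P, H, hAB, hreg⟩ := exists_singular_abTower_of_cheapCascades hq h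
  exact hreg (hL W P H hAB)

/-- **THE LEFT EDGE (L′) ⇒ 24077: `TypeILiouvilleAB → TypeIQuantSubcubicExp`, the crux BY NAME, NO STUB.**
[this file; line theorem] -/
theorem typeIQuantSubcubicExp_of_typeILiouvilleAB (hL : TypeILiouvilleAB) :
    Summit.NavierStokesRegularity.NavierStokesRegularity.Theses.QuarterLogPincer.TypeIQuantSubcubicExp :=
  fun M => quantSubcubicExpAt_of_abLiouvilleAt M (hL M)

/-- **(E1⁺) ∧ (E2) ⇒ 24077**: the two exclusions of 23843's census — no enveloped singular leaf, no
infinite satellite descent — imply the crux (tree `envelopedExclusions_iff_typeILiouvilleAB`).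
[this file; line theorem] -/
theorem typeIQuantSubcubicExp_of_envelopedExclusions
    (h₁ : ∀ M A : ℝ, ¬ EnvelopedLeaf M A) (h₂ : ∀ M : ℝ, ¬ InfiniteDescent M) :
    Summit.NavierStokesRegularity.NavierStokesRegularity.Theses.QuarterLogPincer.TypeIQuantSubcubicExp :=
  typeIQuantSubcubicExp_of_typeILiouvilleAB (envelopedExclusions_iff_typeILiouvilleAB.1 ⟨h₁, h₂⟩)

/-- **THE OBJECT FORM (instrument row)**: if the crux 24077 fails, there are a Type-I constant `M` and
a Type-I ancient mild tower of Albritton–Barker's class, `ABTower M W P H`, which is NOT regular at the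
origin — an object of 23843's satellite-tower census. [this file; line theorem] -/
theorem exists_singular_abTower_of_not_typeIQuantSubcubicExp
    (h : ¬ Summit.NavierStokesRegularity.NavierStokesRegularity.Theses.QuarterLogPincer.TypeIQuantSubcubicExp) :
    ∃ (M : ℝ) (W : ℝ → EuclideanSpace ℝ (Fin 3) → EuclideanSpace ℝ (Fin 3))
      (P : ℝ → EuclideanSpace ℝ (Fin 3) → ℝ)
      (H : ℝ → EuclideanSpace ℝ (Fin 3) → EuclideanSpace ℝ (Fin 3) →L[ℝ] EuclideanSpace ℝ (Fin 3)),
      ABTower M W P H ∧ ¬ RegPt W 0 := by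
  by_contra hno
  push Not at hno
  exact h fun M => quantSubcubicExpAt_of_abLiouvilleAt M fun W P H hAB => hno M W P H hAB

/-- **Any singular A–B tower kills 24077** (contrapositive of the edge at the tower's constant is NOT
available — the edge needs Liouville for ALL towers at `M`; this is the honest object-level statement:
a singular tower refutes `TypeILiouvilleAB`, not 24077).  Recorded as the NEGATIVE READING of the line.
[this file; line theorem] -/
theorem not_typeILiouvilleAB_of_singular_abTower {M : ℝ}
    {W : ℝ → EuclideanSpace ℝ (Fin 3) → EuclideanSpace ℝ (Fin 3)}
    {P : ℝ → EuclideanSpace ℝ (Fin 3) → ℝ}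
    {H : ℝ → EuclideanSpace ℝ (Fin 3) → EuclideanSpace ℝ (Fin 3) →L[ℝ] EuclideanSpace ℝ (Fin 3)}
    (hAB : ABTower M W P H) (hsing : ¬ RegPt W 0) : ¬ TypeILiouvilleAB :=
  fun hL => hsing (hL M W P H hAB)


/-! ### The sharpest left edge: Liouville for THIN A–B towers suffices -/

/-- **THIN-TOWER LIOUVILLE** — the MEET of the two known left hypotheses of 24077: line `thin_cascade`'s
deciding stub S3 (`stub_thinCascadeLiouville`: no thin object at all) and H3's (L′) `TypeILiouvilleAB`
(every A–B tower regular at the origin).  It asks regularity at the origin ONLY of KNSS limits which are BOTH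
thin objects (`ThinObject M q W g`: log-thin annular trace budget, uniform local energy, `SingularAt W 0`) AND
Type-I ancient mild towers of Albritton–Barker's class (`ABTower M W P H`: suitable weak on every `Q(0,a)`,
weak gradient on the slab, `𝐈 < ∞`). [this file; line object] -/
def ThinTowerLiouville : Prop :=
  ∀ (M q : ℝ), 0 < q →
    ∀ (W : ℝ → EuclideanSpace ℝ (Fin 3) → EuclideanSpace ℝ (Fin 3))
      (g : EuclideanSpace ℝ (Fin 3) → EuclideanSpace ℝ (Fin 3))
      (P : ℝ → EuclideanSpace ℝ (Fin 3) → ℝ)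
      (H : ℝ → EuclideanSpace ℝ (Fin 3) → EuclideanSpace ℝ (Fin 3) →L[ℝ] EuclideanSpace ℝ (Fin 3)),
      ThinObject M q W g → ABTower M W P H → RegPt W 0

/-- (L′) ⇒ thin-tower Liouville (forget thinness). [this file; line theorem] -/
theorem thinTowerLiouville_of_typeILiouvilleAB (hL : TypeILiouvilleAB) : ThinTowerLiouville :=
  fun M _ _ W _ P H _ hAB => hL M W P H hAB

/-- S3 of line `thin_cascade` (no thin object at all) ⇒ thin-tower Liouville (forget the tower).
[this file; line theorem] -/
theorem thinTowerLiouville_of_noThinObject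
    (hno : ∀ (M q : ℝ) (v : ℝ → EuclideanSpace ℝ (Fin 3) → EuclideanSpace ℝ (Fin 3))
      (g : EuclideanSpace ℝ (Fin 3) → EuclideanSpace ℝ (Fin 3)), ¬ ThinObject M q v g) :
    ThinTowerLiouville :=
  fun M q _ W g _ _ hthin _ => (hno M q W g hthin).elim

/-- **Cheap cascades of every length produce a THIN SINGULAR A–B TOWER.** [this file; line theorem] -/
theorem exists_thin_singular_abTower_of_cheapCascades {M q : ℝ} (hq : 0 < q)
    (hK : ∀ K : ℕ, CheapCascade M q K) :
    ∃ (W : ℝ → EuclideanSpace ℝ (Fin 3) → EuclideanSpace ℝ (Fin 3))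
      (g : EuclideanSpace ℝ (Fin 3) → EuclideanSpace ℝ (Fin 3))
      (P : ℝ → EuclideanSpace ℝ (Fin 3) → ℝ)
      (H : ℝ → EuclideanSpace ℝ (Fin 3) → EuclideanSpace ℝ (Fin 3) →L[ℝ] EuclideanSpace ℝ (Fin 3)),
      ThinObject M q W g ∧ ABTower M W P H ∧ ¬ RegPt W 0 := by
  obtain ⟨W, g, U, P, H, hthin, hT⟩ := exists_thinObject_and_cascadeTwinLimit_of_cheapCascades hq hK
  exact ⟨W, g, P, H, hthin, abTransfer M W U P H hT⟩

/-- **THE SHARPEST LEFT EDGE: `ThinTowerLiouville → TypeIQuantSubcubicExp`** (crux BY NAME, NO STUB) — it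
FACTORS both known left edges (`typeIQuantSubcubicExp_of_typeILiouvilleAB` above and line `thin_cascade`'s
`S3 ⇒ 24077`). [this file; line theorem] -/
theorem typeIQuantSubcubicExp_of_thinTowerLiouville (hL : ThinTowerLiouville) :
    Summit.NavierStokesRegularity.NavierStokesRegularity.Theses.QuarterLogPincer.TypeIQuantSubcubicExp := by
  intro M
  refine quantSubcubicExpAt_of_forbiddenLengths M fun q hq => ?_
  by_contra h
  push Not at h
  obtain ⟨W, g, P, H, hthin, hAB, hreg⟩ := exists_thin_singular_abTower_of_cheapCascades hq h
  exact hreg (hL M q hq W g P H hthin hAB)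

/-- **OBJECT FORM, sharpened (instrument row)**: if 24077 fails, there are `M`, `q > 0` and a KNSS limit `W`
which is a THIN OBJECT and a Type-I ancient mild A–B TOWER, NOT regular at the origin.
[this file; line theorem] -/
theorem exists_thin_singular_abTower_of_not_typeIQuantSubcubicExp
    (h : ¬ Summit.NavierStokesRegularity.NavierStokesRegularity.Theses.QuarterLogPincer.TypeIQuantSubcubicExp) :
    ∃ (M q : ℝ), 0 < q ∧ ∃ (W : ℝ → EuclideanSpace ℝ (Fin 3) → EuclideanSpace ℝ (Fin 3))
      (g : EuclideanSpace ℝ (Fin 3) → EuclideanSpace ℝ (Fin 3))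
      (P : ℝ → EuclideanSpace ℝ (Fin 3) → ℝ)
      (H : ℝ → EuclideanSpace ℝ (Fin 3) → EuclideanSpace ℝ (Fin 3) →L[ℝ] EuclideanSpace ℝ (Fin 3)),
      ThinObject M q W g ∧ ABTower M W P H ∧ ¬ RegPt W 0 := by
  by_contra hno
  push Not at hno
  exact h (typeIQuantSubcubicExp_of_thinTowerLiouville
    fun M q hq W g P H hthin hAB => hno M q hq W g P H hthin hAB)

end Summit.NavierStokesRegularity.NavierStokesRegularity.Cruxes.TypeIQuantSubcubicExp.AbRoot

end
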